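import Literature.AlgebraicGeometry.Motives.AbelianVarietyProjectiveChart
import Literature.AlgebraicGeometry.Motives.PrymVariety
import Literature.AlgebraicGeometry.Motives.Jacobian
import Literature.AlgebraicGeometry.HodgeTheory.WeilClassesCyclicPrym
import HarnessLib

/-!
# Crux `HyperbolicEightfoldsSqrtMinus7` (stmt-HodgeConjecture-14642), line `Sketch`
# (idea `dicyclic-quaternion-switch`) · Stub 6a `stub_dicyclicAlgebra`

Route `HeckePrymWeil`.  The DICYCLIC DATUM: a curve `C` with automorphisms `α` (`α⁶ = 𝟙`) and `ξ`
with `ξ² = α³`, `αξα = ξ` (a `Dic₃`-action), `s = α_*`, `x = ξ_*` on a Jacobian `J` of `C`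
(`Jacobian.pushforward`), Schoen's primitive Prym `B := (ker Φ₆(s))⁰ = (ker (𝟙 - s + s²))⁰`
(`AbelianVariety.kerComponent`) with its monomorphism `ι : B ↪ J` (`AbelianVariety.kerComponentι`,
`kerComponentι_comp : ι ≫ Φ₆(s) = 0`) and the restrictions `s_B`, `x_B` of `s`, `x` along `ι`.
This file proves the pure preadditive-category algebra of the line: the endomorphisms
`ψ₀ := 𝟙 + 2 s_B²` and `φ₀ := 𝟙 + 2 x_B + 2 s_B²` of `B` satisfy

  `φ₀ ∘ φ₀ = -7`   and   `φ₀ ∘ ψ₀ + ψ₀ ∘ φ₀ = -6`,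

i.e. `ℤ[φ₀] = ℤ[√-7]` acts on `B` and `(φ₀, ψ₀)` generate (the image of) the definite quaternion
algebra `(-1,-3)_ℚ ⊂ ℚ[Dic₃]` (`(1 + 2x + 2a²)² = -7` in that component).

## Proof

* `Φ₆(s_B) = 0` (`kerComponent_cyclotomic₆_restrict_eq_zero`), so `s_B² = s_B - 𝟙`
  (`comp_self_eq_of_cyclotomic₆`) and `s_B³ = -𝟙` (`kerComponent_restrict_comp_pow_three`).
* Albanese functoriality (`Jacobian.pushforward_comp`) pushes the curve relations forward:
  `x² = s³` and `s x s = x` on `J`.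
* Restricting along the monomorphism `ι` (`cancel_mono`): `x_B² = s_B³ = -𝟙` and `s_B x_B s_B = x_B`.
* Multiplying `s_B x_B s_B = x_B` by `s_B²` and using `s_B³ = -𝟙`, `s_B² = s_B - 𝟙`:
  `x_B s_B + s_B x_B = x_B`.
* With `S := s_B`, `X := x_B`: `φ₀ = 2X + 2S - 𝟙`, `ψ₀ = 2S - 𝟙`, and expanding,
  `φ₀² = 4X² + 4(XS + SX) + 4S² - 4X - 4S + 𝟙 = -7`,
  `φ₀ψ₀ + ψ₀φ₀ = 4(XS + SX) + 8S² - 4X - 8S + 2·𝟙 = -6`.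

No named fact is used; the hypothesis `α⁶ = 𝟙` of the registered signature is not needed (on `B` it
follows from `Φ₆(s_B) = 0`).
-/

noncomputable section
-- every declaration of this problem lives in Summit.HodgeConjecture.HodgeConjecture.… (summit = sub-problem)
set_option linter.dupNamespace false

open CategoryTheory
open Literature.AlgebraicGeometry Literature.AlgebraicGeometry.Motives
  Literature.AlgebraicGeometry.HodgeTheory

namespace Summit.HodgeConjecture.HodgeConjecture.Theorems.HyperbolicEightfoldsSqrtMinus7.DicyclicQuaternionSwitch

section Intertwine

variable {𝒞 : Type*} [Category 𝒞] {B J : 𝒞} {ι : B ⟶ J}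

/-- Restrictions along `ι` compose: if `u_B ≫ ι = ι ≫ u` and `v_B ≫ ι = ι ≫ v` then
`(u_B ≫ v_B) ≫ ι = ι ≫ (u ≫ v)`. -/
theorem comp_intertwine {uB vB : B ⟶ B} {u v : J ⟶ J} (hu : uB ≫ ι = ι ≫ u)
    (hv : vB ≫ ι = ι ≫ v) : (uB ≫ vB) ≫ ι = ι ≫ (u ≫ v) := by
  rw [Category.assoc, hv, ← Category.assoc, hu, Category.assoc]

end Intertwine

section DicyclicAlgebra

variable {𝒞 : Type*} [Category 𝒞] [Preadditive 𝒞] {X : 𝒞} {S T : X ⟶ X}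

/-- In any representation of `Dic₃ = ⟨a, x | a⁶ = 1, x² = a³, a x a = x⟩` (`a ↦ S`, `x ↦ T`)
with `Φ₆(S) = 0`: from `S² = S - 𝟙`, `S³ = -𝟙` and `S T S = T` one gets `T S = T - S T`
(multiply `S T S = T` on the left by `S²`). -/
theorem comp_eq_sub_comp_of_dicyclic (h2 : S ≫ S = S - 𝟙 X) (h3 : S ≫ S ≫ S = -𝟙 X)
    (hSTS : S ≫ T ≫ S = T) : T ≫ S = T - S ≫ T := by
  have e : (S ≫ S ≫ S) ≫ T ≫ S = (S ≫ S) ≫ T := by simp only [Category.assoc, hSTS]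
  rw [h3, h2] at e
  simp only [Preadditive.neg_comp, Category.id_comp, Preadditive.sub_comp] at e
  rw [← neg_neg (T ≫ S), e]
  abel

/-- **The `√-7` of the dicyclic datum.**  If `S² = S - 𝟙`, `T² = -𝟙` and `T S = T - S T`
(the relations of the images of `a`, `x ∈ Dic₃` in the quaternion component `(-1,-3)_ℚ` of
`ℚ[Dic₃]`), then `φ₀ := 𝟙 + 2T + 2S²` has `φ₀² = -7`
(`(2T + 2S - 1)² = 4T² + 4(TS + ST) + 4S² - 4T - 4S + 1 = -4 + 4T + 4S - 4 - 4T - 4S + 1`). -/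
theorem dicyclic_phi_comp_self (h2 : S ≫ S = S - 𝟙 X) (hTT : T ≫ T = -𝟙 X)
    (hTS : T ≫ S = T - S ≫ T) {φ₀ : X ⟶ X} (hφ₀ : φ₀ = 𝟙 X + 2 • T + 2 • (S ≫ S)) :
    φ₀ ≫ φ₀ = -((7 : ℤ) • 𝟙 X) := by
  have hφ' : φ₀ = 2 • T + 2 • S - 𝟙 X := by rw [hφ₀, h2]; abel
  rw [hφ']
  simp only [Preadditive.add_comp, Preadditive.comp_add, Preadditive.sub_comp,
    Preadditive.comp_sub, Preadditive.nsmul_comp, Preadditive.comp_nsmul, Category.id_comp,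
    Category.comp_id, hTT, hTS, h2]
  abel

/-- **The anticommutator.**  Under the same relations, `ψ₀ := 𝟙 + 2S²` (`ψ₀² = -3`) and
`φ₀ := 𝟙 + 2T + 2S²` satisfy `φ₀ ψ₀ + ψ₀ φ₀ = -6`. -/
theorem dicyclic_phi_psi_anticomm (h2 : S ≫ S = S - 𝟙 X) (hTS : T ≫ S = T - S ≫ T)
    {ψ₀ φ₀ : X ⟶ X} (hψ₀ : ψ₀ = 𝟙 X + 2 • (S ≫ S))
    (hφ₀ : φ₀ = 𝟙 X + 2 • T + 2 • (S ≫ S)) :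
    φ₀ ≫ ψ₀ + ψ₀ ≫ φ₀ = (-6 : ℤ) • 𝟙 X := by
  have hφ' : φ₀ = 2 • T + 2 • S - 𝟙 X := by rw [hφ₀, h2]; abel
  have hψ' : ψ₀ = 2 • S - 𝟙 X := by rw [hψ₀, h2]; abel
  rw [hφ', hψ']
  simp only [Preadditive.add_comp, Preadditive.comp_add, Preadditive.sub_comp,
    Preadditive.comp_sub, Preadditive.nsmul_comp, Preadditive.comp_nsmul, Category.id_comp,
    Category.comp_id, hTS, h2]
  abel

end DicyclicAlgebra

/-- **Stub 6a `stub_dicyclicAlgebra` — the `√-7` and its anticommutator with Schoen's `√-3` on the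
primitive Prym of a dicyclic curve (pure preadditive algebra).**  For a curve `C` with a Jacobian `𝒥`
and automorphisms `α`, `ξ` with `α⁶ = 𝟙`, `ξ² = α³`, `αξα = ξ` (a `Dic₃`-action), `s = α_*`,
`x = ξ_*`, and restrictions `s_B`, `x_B` of `s`, `x` to `B = (ker Φ₆(s))⁰` along the monomorphism
`ι = kerComponentι`, the endomorphisms `ψ₀ = 𝟙 + 2 s_B²`, `φ₀ = 𝟙 + 2 x_B + 2 s_B²` of `B` satisfy
`φ₀² = -7` and `φ₀ψ₀ + ψ₀φ₀ = -6`.  Proof: `Φ₆(s_B) = 0` gives `s_B² = s_B - 𝟙`, `s_B³ = -𝟙`;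
functoriality of `α ↦ α_*` gives `x² = s³`, `s x s = x` on `J`, hence (cancelling the mono `ι`)
`x_B² = s_B³ = -𝟙`, `s_B x_B s_B = x_B` on `B`; then `x_B s_B + s_B x_B = x_B` and the two identities
are the expansions in `dicyclic_phi_comp_self`, `dicyclic_phi_psi_anticomm`. -/
theorem stub_dicyclicAlgebra :
    ∀ (C : SchemeOver ℂ) (𝒥 : Jacobian C) (α ξ : C ⟶ C),
      α ≫ α ≫ α ≫ α ≫ α ≫ α = 𝟙 C → ξ ≫ ξ = α ≫ α ≫ α → α ≫ ξ ≫ α = ξ →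
    ∀ (s x : 𝒥.J ⟶ 𝒥.J), s = 𝒥.pushforward 𝒥 α → x = 𝒥.pushforward 𝒥 ξ →
    ∀ (sB xB ψ₀ φ₀ : AbelianVariety.kerComponent (𝟙 𝒥.J - s + s ≫ s) ⟶
        AbelianVariety.kerComponent (𝟙 𝒥.J - s + s ≫ s)),
      sB ≫ AbelianVariety.kerComponentι (𝟙 𝒥.J - s + s ≫ s) =
        AbelianVariety.kerComponentι (𝟙 𝒥.J - s + s ≫ s) ≫ s →
      xB ≫ AbelianVariety.kerComponentι (𝟙 𝒥.J - s + s ≫ s) =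
        AbelianVariety.kerComponentι (𝟙 𝒥.J - s + s ≫ s) ≫ x →
      ψ₀ = 𝟙 _ + 2 • (sB ≫ sB) →
      φ₀ = 𝟙 _ + 2 • xB + 2 • (sB ≫ sB) →
      φ₀ ≫ φ₀ = -((7 : ℤ) • 𝟙 _) ∧ φ₀ ≫ ψ₀ + ψ₀ ≫ φ₀ = (-6 : ℤ) • 𝟙 _ := by
  intro C 𝒥 α ξ _hα6 hξ2 hrel s x hs hx sB xB ψ₀ φ₀ hsB hxB hψ₀ hφ₀
  -- `Φ₆(s_B) = 0`: `s_B² = s_B - 𝟙`, `s_B³ = -𝟙`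
  have h2 : sB ≫ sB = sB - 𝟙 _ :=
    comp_self_eq_of_cyclotomic₆ (kerComponent_cyclotomic₆_restrict_eq_zero hsB)
  have h3 : sB ≫ sB ≫ sB = -𝟙 _ := kerComponent_restrict_comp_pow_three hsB
  -- the curve relations pushed forward to `J`
  have hxx : x ≫ x = s ≫ s ≫ s := by
    rw [hx, hs]
    simp only [← Jacobian.pushforward_comp, hξ2]
  have hsxs : s ≫ x ≫ s = x := by
    rw [hx, hs]
    simp only [← Jacobian.pushforward_comp, hrel]
  -- restricted to `B` along the monomorphism `ι`
  have hxBxB : xB ≫ xB = -𝟙 _ := by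
    rw [← h3, ← cancel_mono (AbelianVariety.kerComponentι (𝟙 𝒥.J - s + s ≫ s)),
      comp_intertwine hxB hxB, comp_intertwine hsB (comp_intertwine hsB hsB), hxx]
  have hsxsB : sB ≫ xB ≫ sB = xB := by
    rw [← cancel_mono (AbelianVariety.kerComponentι (𝟙 𝒥.J - s + s ≫ s)),
      comp_intertwine hsB (comp_intertwine hxB hsB), hsxs, hxB]
  -- the `Dic₃` algebra
  have hxs : xB ≫ sB = xB - sB ≫ xB := comp_eq_sub_comp_of_dicyclic h2 h3 hsxsB
  exact ⟨dicyclic_phi_comp_self h2 hxBxB hxs hφ₀, dicyclic_phi_psi_anticomm h2 hxs hψ₀ hφ₀⟩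

end Summit.HodgeConjecture.HodgeConjecture.Theorems.HyperbolicEightfoldsSqrtMinus7.DicyclicQuaternionSwitch

end
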